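import Mathlib
import HarnessLib
import Literature.MathematicalPhysics.KineticTheory.HardSphereEulerProofs
import Literature.Analysis.FluidPDE.CollisionalTransfer
import Summits.AtomisticToContinuum.HydrodynamicLimit.Theses.OneFlightGossipEngine
import Summits.AtomisticToContinuum.HydrodynamicLimit.Theorems.OneFlightGossipEngineKineticCurrentsLDAlongFamiliesWindowRenyiOfTransport

/-!
# Rényi quasi-invariance with the ORDER AFTER THE BUDGET is static — helper toward the open stub
# `stub_windowRenyiFamily` / `stub_windowTransportFamily` of line `Sketch`, crux `KineticCurrentsLDAlongFamilies`
# (stmt-AtomisticToContinuum-16659)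

Route `OneFlightGossipEngine`, sub-problem `HydrodynamicLimit`. The registered dynamical input S2 of the
skeleton `Cruxes/KineticCurrentsLDAlongFamilies/Lines/Sketch.lean` asks for ONE Rényi order `p > 1` such that
for EVERY budget `δ > 0` the quasi-invariance `∫ (ψ_s∘Φ_{-r})^p ψ_s^{1-p} dL ≤ e^{pδ(N+1)}` of the canonical
local Gibbs density `ψ_s` holds over the kinetic window for all large `N`, uniformly along the family. This
file proves, WITHOUT ANY DYNAMICAL INPUT beyond Liouville invariance and conservation of the kinetic energy,
the same inequality with the two binders swapped — `∀ δ > 0 ∃ p > 1` — and in a stronger form: for EVERY `N`,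
EVERY hard-sphere flow and EVERY time `r ∈ ℝ` (no window, no threshold `N₀`).

WHY (the mechanism, for planners and the disprover). After the Liouville change of variables `z = Φ_r w`
the Rényi integral is `E_{λ_s}[exp((p−1)(H_s(Φ_r w) − H_s(w)))]`, `H_s = −Σᵢ g̃_s(xᵢ) − M_{u_s/θ_s} + E_{1/θ_s}`
the modular Hamiltonian (cocycle `stub_windowRenyi_prelim`). The forward increase of `H_s` is at most
`(N+1)(2B + Θ′U) + (2Θ′U + Θ′)·E(w)` (`B` a bound of `g̃_s`, `Θ′` of `θ_s⁻¹`, `U` of `‖u_s‖` on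
`[0,t₁] × 𝕋³`; `E(Φ_r w) = E(w)` on the good set), so for `p − 1` small — chosen AFTER `δ` — the per-particle
term is `≤ δ/2` and the energy coefficient is below the Gaussian threshold `γ(δ/2, Θ, U)` of
`lintegral_exp_mul_configEnergy_localGibbsLaw_le`. Hence the ENTIRE dynamical content of S2 (equivalently of
the transport stub S2'', whose `∀ κ ∃ s₀` version is the same static estimate) is the uniformity of the order
`p` (of the rate `s₀`) in the budget: an LD upper bound with a positive slope at zero for the forward entropy
production `H_s∘Φ_r − H_s` under `λ_s`, which is forced by the crux's `∃ β₀` before `∀ ε` through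
`q = p/(p−1)` in the window transfer and `8qγΘ ≤ 1` in the fibre tails.

References: S. Olla, S. R. S. Varadhan, H.-T. Yau, Comm. Math. Phys. 155 (1993) §2 (relative entropy and
its production along Hamiltonian flows); H. Spohn, *Large Scale Dynamics of Interacting Particles* (1991),
Part I §2.3.
-/

noncomputable section

open MeasureTheory Set Filter
open scoped ENNReal Topology InnerProductSpace

namespace Summit.AtomisticToContinuum.HydrodynamicLimit.Theorems.KineticCurrentsLDAlongFamiliesSketch

open Literature.Analysis.FluidPDE (HardSphereFlow Config localMaxwellian canonicalDensity liouville
  hardSphereDomain energyObservable momentumObservable configEnergy)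
open Literature.MathematicalPhysics.KineticTheory (T3 V3 hsDiameter localGibbsLaw localGibbsMeasure
  localGibbsProfile)
open Literature.Analysis.FluidPDE Literature.MathematicalPhysics.KineticTheory
open Summit.AtomisticToContinuum.HydrodynamicLimit.Theorems.KineticCurrentsWindowLDUniformLocalGibbs
  (wre_exists_gamma wre_canonicalDensity_pos_of_mem stub_windowRenyi_prelim)

/-! ### Static bounds of the tested fields by the kinetic energy -/

/-- `|M_J(z)| ≤ ‖J‖_∞ ((n) + 2E(z))/2`-type bound: for `‖J x‖ ≤ c`,
`|momentumObservable J z| ≤ c * (n / 2 + configEnergy z)` (`‖v‖ ≤ (1 + ‖v‖²)/2`). [folklore] -/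
theorem wrw_abs_momentumObservable_le {n : ℕ} {J : T3 → V3} {c : ℝ} (hc0 : 0 ≤ c)
    (hc : ∀ x, ‖J x‖ ≤ c) (z : Config n (Fin 3) T3) :
    |momentumObservable J z| ≤ c * ((n : ℝ) / 2 + configEnergy z) := by
  unfold momentumObservable configEnergy
  calc |∑ i, ⟪J (z i).1, (z i).2⟫_ℝ| ≤ ∑ i, |⟪J (z i).1, (z i).2⟫_ℝ| := Finset.abs_sum_le_sum_abs _ _
    _ ≤ ∑ i, c * ((1 + ‖(z i).2‖ ^ 2) / 2) := by
        refine Finset.sum_le_sum fun i _ => ?_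
        calc |⟪J (z i).1, (z i).2⟫_ℝ| ≤ ‖J (z i).1‖ * ‖(z i).2‖ := abs_real_inner_le_norm _ _
          _ ≤ c * ‖(z i).2‖ := mul_le_mul_of_nonneg_right (hc _) (norm_nonneg _)
          _ ≤ c * ((1 + ‖(z i).2‖ ^ 2) / 2) := by
              refine mul_le_mul_of_nonneg_left ?_ hc0
              nlinarith [sq_nonneg (‖(z i).2‖ - 1)]
    _ = c * ((n : ℝ) / 2 + 2⁻¹ * ∑ i, ‖(z i).2‖ ^ 2) := by
        rw [← Finset.mul_sum]
        congr 1
        have h2 : ∀ i : Fin n, (1 + ‖(z i).2‖ ^ 2) / 2 = 1 / 2 + 2⁻¹ * ‖(z i).2‖ ^ 2 :=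
          fun i => by ring
        simp_rw [h2, Finset.sum_add_distrib, Finset.sum_const, Finset.card_univ, Fintype.card_fin,
          nsmul_eq_mul, ← Finset.mul_sum]
        ring

/-- For `0 ≤ ϑ x ≤ c`, `0 ≤ energyObservable ϑ z ≤ c * configEnergy z`. [folklore] -/
theorem wrw_energyObservable_le {n : ℕ} {ϑ : T3 → ℝ} {c : ℝ} (h0 : ∀ x, 0 ≤ ϑ x)
    (hc : ∀ x, ϑ x ≤ c) (z : Config n (Fin 3) T3) :
    0 ≤ energyObservable ϑ z ∧ energyObservable ϑ z ≤ c * configEnergy z := by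
  unfold energyObservable configEnergy
  have hv : ∀ i : Fin n, 0 ≤ ‖(z i).2‖ ^ 2 / 2 := fun i => div_nonneg (sq_nonneg _) zero_le_two
  refine ⟨Finset.sum_nonneg fun i _ => mul_nonneg (h0 _) (hv i), ?_⟩
  calc ∑ i, ϑ (z i).1 * (‖(z i).2‖ ^ 2 / 2) ≤ ∑ i, c * (‖(z i).2‖ ^ 2 / 2) :=
        Finset.sum_le_sum fun i _ => mul_le_mul_of_nonneg_right (hc _) (hv i)
    _ = c * (2⁻¹ * ∑ i, ‖(z i).2‖ ^ 2) := by
        rw [Finset.mul_sum, Finset.mul_sum]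
        exact Finset.sum_congr rfl fun i _ => by ring

/-! ### The static Rényi bound: order after budget, every `N`, every flow, every time -/

/-- **Rényi quasi-invariance of the canonical local Gibbs density with the order chosen after the
budget is static.** For a jointly continuous positive profile family on `[0,t₁] × 𝕋³`, `σ ≤ 1/2` and a
budget `δ > 0` there is an order `p > 1` such that for EVERY `N`, every hard-sphere flow `Φ` of `N+1`
spheres of diameter `σ(N+1)^{-1/3}`, every `s ∈ [0,t₁]` and every time `r ∈ ℝ`:
`∫ (ψ_s∘Φ_{-r})^p ψ_s^{1-p} dL ≤ e^{pδ(N+1)}`. Proof: Liouville change of variables, the cocycle of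
`ψ_s` through its modular Hamiltonian, the crude bounds `|Δ Σ g̃_s| ≤ 2B(N+1)`,
`|M_{u/θ}| ≤ Θ′U((N+1)/2 + E)`, `0 ≤ E_{1/θ} ≤ Θ′E`, conservation of `E` on the good set, and the Gaussian
moment `∫ e^{γE} dλ_s ≤ (e^{γU²}(1−2γΘ)^{-3/2})^{N+1}`; `p − 1 := min(δ/(2(2B+Θ′U+1)), γ/(2Θ′U+Θ′+1))`.
[folklore] -/
theorem windowRenyiFamily_orderAfterBudget :
    ∀ (t₁ : ℝ) (a θ₀ : ℝ → T3 → ℝ) (u₀ : ℝ → T3 → V3),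
    Continuous (Function.uncurry a) → Continuous (Function.uncurry θ₀) →
    Continuous (Function.uncurry u₀) → (∀ s x, 0 < a s x) → (∀ s x, 0 < θ₀ s x) →
    ∀ σ : ℝ, σ ≤ 1 / 2 → ∀ δ : ℝ, 0 < δ →
    ∃ p : ℝ, 1 < p ∧ ∀ (N : ℕ)
      (Φ : HardSphereFlow (Literature.Analysis.FluidPDE.Torus.geometry (Fin 3)) (hsDiameter σ N) (N + 1)),
    ∀ s ∈ Icc 0 t₁, ∀ r : ℝ,
      ∫⁻ z, ENNReal.ofReal (canonicalDensity (Literature.Analysis.FluidPDE.Torus.geometry (Fin 3))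
            (hsDiameter σ N) (N + 1) (localGibbsProfile (a s) (u₀ s) (θ₀ s)) (Φ.flow (-r) z)) ^ p *
          ENNReal.ofReal (canonicalDensity (Literature.Analysis.FluidPDE.Torus.geometry (Fin 3))
            (hsDiameter σ N) (N + 1) (localGibbsProfile (a s) (u₀ s) (θ₀ s)) z) ^ (1 - p)
        ∂(liouville (Literature.Analysis.FluidPDE.Torus.geometry (Fin 3)) (N + 1) (hsDiameter σ N)) ≤
      ENNReal.ofReal (Real.exp (p * (δ * ((N : ℝ) + 1)))) := by
  intro t₁ a θ₀ u₀ ha hθ hu ha0 hθ0 σ hσ2 δ hδ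
  -- the data: `ϑ_s = θ₀⁻¹`, `J_s = θ₀⁻¹ • u₀`, the position part `g̃_s`
  have hϑc : Continuous (Function.uncurry fun s x => (θ₀ s x)⁻¹) :=
    hθ.inv₀ fun q => (hθ0 q.1 q.2).ne'
  have hJc : Continuous (Function.uncurry fun s x => (θ₀ s x)⁻¹ • u₀ s x) := hϑc.smul hu
  set gt : ℝ → T3 → ℝ := fun s x => Real.log (a s x) +
      (-(Module.finrank ℝ V3 : ℝ) / 2) * Real.log (2 * Real.pi * θ₀ s x) -
      (θ₀ s x)⁻¹ * ‖u₀ s x‖ ^ 2 / 2 with hgt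
  have hgtc : Continuous (Function.uncurry gt) := by
    refine ((ha.log fun q => (ha0 q.1 q.2).ne').add (continuous_const.mul
      ((continuous_const.mul hθ).log fun q => ?_))).sub ((hϑc.mul (hu.norm.pow 2)).div_const 2)
    exact (mul_pos (mul_pos two_pos Real.pi_pos) (hθ0 q.1 q.2)).ne'
  -- uniform bounds on `[0,t₁] × 𝕋³`
  obtain ⟨Θ, hΘ0, hΘ'⟩ := wrf_exists_forall_le_family hθ t₁
  obtain ⟨Θi, hΘi0, hΘi'⟩ := wrf_exists_forall_le_family (f := fun s x => (θ₀ s x)⁻¹) hϑc t₁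
  obtain ⟨U, hU0, hU'⟩ := wrf_exists_forall_le_family (f := fun s x => ‖u₀ s x‖) hu.norm t₁
  obtain ⟨B₁, hB₁0, hB₁⟩ := wrf_exists_forall_le_family hgtc t₁
  obtain ⟨B₂, hB₂0, hB₂⟩ := wrf_exists_forall_le_family (f := fun s x => -gt s x) hgtc.neg t₁
  set B : ℝ := max B₁ B₂ with hB
  have hBabs : ∀ s ∈ Icc (0 : ℝ) t₁, ∀ x, |gt s x| ≤ B := fun s hs x =>
    abs_le.2 ⟨by linarith [hB₂ s hs x, le_max_right B₁ B₂], (hB₁ s hs x).trans (le_max_left _ _)⟩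
  have hB0 : 0 ≤ B := hB₁0.le.trans (le_max_left _ _)
  -- the Gaussian exponent for the budget `δ/2`, then the order `p`
  obtain ⟨γ, hγ0, hγΘ, hK⟩ := wre_exists_gamma hΘ0 (half_pos hδ) U
  set c₁ : ℝ := 2 * B + Θi * U with hc₁
  set c₂ : ℝ := 2 * (Θi * U) + Θi with hc₂
  have hc₁0 : 0 ≤ c₁ := by positivity
  have hc₂0 : 0 ≤ c₂ := by positivity
  set e : ℝ := min (δ / (2 * (c₁ + 1))) (γ / (c₂ + 1)) with he
  have he0 : 0 < e := lt_min (by positivity) (by positivity)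
  have he₁ : e * c₁ ≤ δ / 2 := by
    have h1 : e ≤ δ / (2 * (c₁ + 1)) := min_le_left _ _
    have h2 : e * (c₁ + 1) ≤ δ / 2 := by
      rw [le_div_iff₀ (by positivity)] at h1
      linarith
    nlinarith
  have he₂ : e * c₂ ≤ γ := by
    have h1 : e ≤ γ / (c₂ + 1) := min_le_right _ _
    rw [le_div_iff₀ (by positivity)] at h1
    nlinarith
  refine ⟨1 + e, by linarith, ?_⟩
  intro N Φ s hsI r
  set p : ℝ := 1 + e with hp
  have hp0 : 0 < p := by rw [hp]; positivity
  have hp1 : 1 < p := by rw [hp]; linarith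
  -- the profiles at the parameter `s`
  have has : Continuous (a s) := ha.uncurry_left s
  have hθs : Continuous (θ₀ s) := hθ.uncurry_left s
  have hus : Continuous (u₀ s) := hu.uncurry_left s
  have ha0s : ∀ x, 0 < a s x := ha0 s
  have hθ0s : ∀ x, 0 < θ₀ s x := hθ0 s
  have hϑs : Continuous fun x => (θ₀ s x)⁻¹ := hϑc.uncurry_left s
  have hJs : Continuous fun x => (θ₀ s x)⁻¹ • u₀ s x := hJc.uncurry_left s
  -- the Liouville measure, the density `ψ_s`, the law `λ_s`
  set L := liouville (Torus.geometry (Fin 3)) (N + 1) (hsDiameter σ N) with hL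
  set ψr : Config (N + 1) (Fin 3) T3 → ℝ := fun z =>
    canonicalDensity (Torus.geometry (Fin 3)) (hsDiameter σ N) (N + 1)
      (localGibbsProfile (a s) (u₀ s) (θ₀ s)) z with hψr
  set ψ : Config (N + 1) (Fin 3) T3 → ℝ≥0∞ := fun z => ENNReal.ofReal (ψr z) with hψ
  have hlaw : localGibbsLaw σ (a s) (u₀ s) (θ₀ s) N Φ = L.withDensity ψ := by
    simp only [localGibbsLaw, particleLaw_eq, hL, hψ, hψr]
  have hψm : Measurable ψ :=
    (measurable_canonicalDensity (hsDiameter σ N) (N + 1)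
      (measurable_localGibbsProfile has hθs hus)).ennreal_ofReal
  -- the exponential weight
  set F₁ : Config (N + 1) (Fin 3) T3 → ℝ≥0∞ := fun w => ENNReal.ofReal
    (Real.exp (δ / 2 * ((N : ℝ) + 1) + γ * configEnergy w)) with hF₁
  have hEm : Measurable fun z : Config (N + 1) (Fin 3) T3 => configEnergy z := by
    unfold configEnergy
    exact measurable_const.mul (Finset.measurable_sum _ fun i _ =>
      ((measurable_pi_apply i).snd.norm.pow_const 2))
  have hF₁m : Measurable F₁ :=
    (Real.measurable_exp.comp (measurable_const.add (measurable_const.mul hEm))).ennreal_ofReal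
  -- Step 1: Liouville change of variables `z = Φ_r w`
  have h1 : ∫⁻ z, ψ (Φ.flow (-r) z) ^ p * ψ z ^ (1 - p) ∂L =
      ∫⁻ w, ψ w ^ p * ψ (Φ.flow r w) ^ (1 - p) ∂L := by
    have hmeas : Measurable fun z => ψ (Φ.flow (-r) z) ^ p * ψ z ^ (1 - p) :=
      ((hψm.comp (Φ.measurable_flow (-r))).pow_const p).mul (hψm.pow_const (1 - p))
    rw [← (Φ.measurePreserving r).lintegral_comp hmeas]
    refine lintegral_congr_ae ?_
    filter_upwards [Φ.ae_mem_good] with w hw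
    simp only [Φ.flow_neg_flow r hw]
  -- Step 2: pointwise bound on the good set
  have hpt : ∀ᵐ w ∂L, ψ w ^ p * ψ (Φ.flow r w) ^ (1 - p) ≤ ψ w * F₁ w := by
    filter_upwards [Φ.ae_mem_good] with w hw
    have hz : Φ.flow r w ∈ Φ.good := Φ.mapsTo_good r hw
    have hDw := Φ.good_subset hw
    have hDz := Φ.good_subset hz
    have hwpos : 0 < ψr w := wre_canonicalDensity_pos_of_mem has hθs hus ha0s hθ0s hσ2 hDw
    have hw0 : ψ w ≠ 0 := (ENNReal.ofReal_pos.2 hwpos).ne'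
    -- conservation of the kinetic energy on the good set
    have hEcons : configEnergy (Φ.flow r w) = configEnergy w := by
      have h := IsHardSphereTrajectory.configEnergy_eq_holds (Φ.isTrajectory w hw) r 0
      simpa [Φ.flow_zero w hw] using h
    have hE0 : 0 ≤ configEnergy w := by
      show (0 : ℝ) ≤ 2⁻¹ * ∑ i, ‖(w i).2‖ ^ 2
      exact mul_nonneg (by norm_num) (Finset.sum_nonneg fun i _ => sq_nonneg _)
    -- the exponent `D = ΔG + ΔM − ΔE` of the cocycle
    set D : ℝ := ((∑ i, gt s (Φ.flow r w i).1) - ∑ i, gt s (w i).1) +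
        (momentumObservable (fun x => (θ₀ s x)⁻¹ • u₀ s x) (Φ.flow r w) -
          momentumObservable (fun x => (θ₀ s x)⁻¹ • u₀ s x) w) -
        (energyObservable (fun x => (θ₀ s x)⁻¹) (Φ.flow r w) -
          energyObservable (fun x => (θ₀ s x)⁻¹) w) with hD
    have hcoc : ψr (Φ.flow r w) = ψr w * Real.exp D := by
      simp only [hψr, hD, hgt]
      exact stub_windowRenyi_prelim (a s) (θ₀ s) (u₀ s) ha0s hθ0s σ N w (Φ.flow r w) hDw hDz
    -- the crude bounds of the three parts
    have hG : (∑ i, gt s (w i).1) - ∑ i, gt s (Φ.flow r w i).1 ≤ ((N : ℝ) + 1) * (2 * B) := by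
      rw [← Finset.sum_sub_distrib]
      calc ∑ i, (gt s (w i).1 - gt s (Φ.flow r w i).1) ≤ ∑ _i : Fin (N + 1), 2 * B := by
            refine Finset.sum_le_sum fun i _ => ?_
            linarith [(abs_le.1 (hBabs s hsI (w i).1)).2, (abs_le.1 (hBabs s hsI (Φ.flow r w i).1)).1]
        _ = ((N : ℝ) + 1) * (2 * B) := by
            rw [Finset.sum_const, Finset.card_univ, Fintype.card_fin, nsmul_eq_mul]
            push_cast
            ring
    have hJb : ∀ x, ‖(θ₀ s x)⁻¹ • u₀ s x‖ ≤ Θi * U := fun x => by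
      rw [norm_smul, Real.norm_eq_abs, abs_of_pos (inv_pos.2 (hθ0s x))]
      exact mul_le_mul (hΘi' s hsI x) (hU' s hsI x) (norm_nonneg _) hΘi0.le
    have hM : momentumObservable (fun x => (θ₀ s x)⁻¹ • u₀ s x) w -
        momentumObservable (fun x => (θ₀ s x)⁻¹ • u₀ s x) (Φ.flow r w) ≤
        Θi * U * (((N : ℝ) + 1) + 2 * configEnergy w) := by
      have hΘU : 0 ≤ Θi * U := mul_nonneg hΘi0.le hU0.le
      have h₁ := wrw_abs_momentumObservable_le hΘU hJb w
      have h₂ := wrw_abs_momentumObservable_le hΘU hJb (Φ.flow r w)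
      rw [hEcons] at h₂
      push_cast at h₁ h₂
      have := abs_le.1 h₁
      have := abs_le.1 h₂
      nlinarith [mul_nonneg hΘi0.le hU0.le]
    have hE : energyObservable (fun x => (θ₀ s x)⁻¹) (Φ.flow r w) -
        energyObservable (fun x => (θ₀ s x)⁻¹) w ≤ Θi * configEnergy w := by
      have h₁ := (wrw_energyObservable_le (fun x => (inv_pos.2 (hθ0s x)).le) (hΘi' s hsI) w).1
      have h₂ := (wrw_energyObservable_le (fun x => (inv_pos.2 (hθ0s x)).le) (hΘi' s hsI)
        (Φ.flow r w)).2
      rw [hEcons] at h₂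
      linarith
    have hexp : (1 - p) * D ≤ δ / 2 * ((N : ℝ) + 1) + γ * configEnergy w := by
      have h1p : 1 - p = -e := by rw [hp]; ring
      have hDle : -D ≤ ((N : ℝ) + 1) * c₁ + c₂ * configEnergy w := by
        rw [hD, hc₁, hc₂]
        nlinarith [hG, hM, hE]
      have hN0 : (0 : ℝ) ≤ (N : ℝ) + 1 := by positivity
      calc (1 - p) * D = e * (-D) := by rw [h1p]; ring
        _ ≤ e * (((N : ℝ) + 1) * c₁ + c₂ * configEnergy w) := mul_le_mul_of_nonneg_left hDle he0.le
        _ = (e * c₁) * ((N : ℝ) + 1) + (e * c₂) * configEnergy w := by ring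
        _ ≤ δ / 2 * ((N : ℝ) + 1) + γ * configEnergy w :=
            add_le_add (mul_le_mul_of_nonneg_right he₁ hN0) (mul_le_mul_of_nonneg_right he₂ hE0)
    -- the `ℝ≥0∞` algebra `ψ(w)^p ψ(z)^{1-p} = ψ(w) e^{(1-p) D}`
    calc ψ w ^ p * ψ (Φ.flow r w) ^ (1 - p)
        = ENNReal.ofReal (ψr w) ^ p *
            (ENNReal.ofReal (ψr w) * ENNReal.ofReal (Real.exp D)) ^ (1 - p) := by
          simp only [hψ]
          rw [hcoc, ENNReal.ofReal_mul hwpos.le]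
      _ = ENNReal.ofReal (ψr w) * ENNReal.ofReal (Real.exp D) ^ (1 - p) := by
          rw [ENNReal.mul_rpow_of_ne_top ENNReal.ofReal_ne_top ENNReal.ofReal_ne_top, ← mul_assoc,
            ← ENNReal.rpow_add p (1 - p) hw0 ENNReal.ofReal_ne_top,
            show p + (1 - p) = 1 by ring, ENNReal.rpow_one]
      _ = ENNReal.ofReal (ψr w) * ENNReal.ofReal (Real.exp ((1 - p) * D)) := by
          rw [ENNReal.ofReal_rpow_of_pos (Real.exp_pos _), ← Real.exp_mul, mul_comm D (1 - p)]
      _ ≤ ENNReal.ofReal (ψr w) * F₁ w := by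
          simp only [hF₁]
          exact mul_le_mul_right (ENNReal.ofReal_le_ofReal (Real.exp_le_exp.2 hexp)) _
      _ = ψ w * F₁ w := by simp only [hψ]
  -- Step 3: the Gaussian moment under the local Gibbs law `λ_s`
  have hKN : (Real.exp (γ * U ^ 2) * (1 - 2 * γ * Θ) ^ (-(3 : ℝ) / 2)) ^ (N + 1) ≤
      Real.exp (δ / 2 * ((N : ℝ) + 1)) := by
    have hK0 : 0 ≤ Real.exp (γ * U ^ 2) * (1 - 2 * γ * Θ) ^ (-(3 : ℝ) / 2) :=
      mul_nonneg (Real.exp_nonneg _) (Real.rpow_nonneg (by linarith) _)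
    refine (pow_le_pow_left₀ hK0 hK (N + 1)).trans_eq ?_
    rw [← Real.exp_nat_mul]
    congr 1
    push_cast
    ring
  have hI₁ : ∫⁻ w, F₁ w ∂(localGibbsLaw σ (a s) (u₀ s) (θ₀ s) N Φ) ≤
      ENNReal.ofReal (Real.exp (p * (δ * ((N : ℝ) + 1)))) := by
    have hsplit : ∀ w, F₁ w = ENNReal.ofReal (Real.exp (δ / 2 * ((N : ℝ) + 1))) *
        ENNReal.ofReal (Real.exp (γ * configEnergy w)) := by
      intro w
      simp only [hF₁]
      rw [← ENNReal.ofReal_mul (Real.exp_nonneg _), ← Real.exp_add]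
    have hγm : Measurable fun w : Config (N + 1) (Fin 3) T3 =>
        ENNReal.ofReal (Real.exp (γ * configEnergy w)) :=
      (Real.measurable_exp.comp (measurable_const.mul hEm)).ennreal_ofReal
    have hδN : Real.exp (δ / 2 * ((N : ℝ) + 1)) * Real.exp (δ / 2 * ((N : ℝ) + 1)) ≤
        Real.exp (p * (δ * ((N : ℝ) + 1))) := by
      rw [← Real.exp_add, Real.exp_le_exp]
      have hN0 : (0 : ℝ) ≤ δ * ((N : ℝ) + 1) := by positivity
      nlinarith
    calc ∫⁻ w, F₁ w ∂(localGibbsLaw σ (a s) (u₀ s) (θ₀ s) N Φ)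
        = ENNReal.ofReal (Real.exp (δ / 2 * ((N : ℝ) + 1))) *
            ∫⁻ w, ENNReal.ofReal (Real.exp (γ * configEnergy w))
              ∂(localGibbsLaw σ (a s) (u₀ s) (θ₀ s) N Φ) := by
          simp_rw [hsplit]
          rw [lintegral_const_mul _ hγm]
      _ ≤ ENNReal.ofReal (Real.exp (δ / 2 * ((N : ℝ) + 1))) *
            ENNReal.ofReal ((Real.exp (γ * U ^ 2) * (1 - 2 * γ * Θ) ^ (-(3 : ℝ) / 2)) ^ (N + 1)) :=
          mul_le_mul_right
            (lintegral_exp_mul_configEnergy_localGibbsLaw_le has hθs hus ha0s hθ0s hσ2 N Φ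
              hγ0.le (hΘ' s hsI) (hU' s hsI) hγΘ) _
      _ ≤ ENNReal.ofReal (Real.exp (δ / 2 * ((N : ℝ) + 1))) *
            ENNReal.ofReal (Real.exp (δ / 2 * ((N : ℝ) + 1))) :=
          mul_le_mul_right (ENNReal.ofReal_le_ofReal hKN) _
      _ ≤ ENNReal.ofReal (Real.exp (p * (δ * ((N : ℝ) + 1)))) := by
          rw [← ENNReal.ofReal_mul (Real.exp_nonneg _)]
          exact ENNReal.ofReal_le_ofReal hδN
  -- Step 4: assemble
  calc ∫⁻ z, ψ (Φ.flow (-r) z) ^ p * ψ z ^ (1 - p) ∂L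
      = ∫⁻ w, ψ w ^ p * ψ (Φ.flow r w) ^ (1 - p) ∂L := h1
    _ ≤ ∫⁻ w, ψ w * F₁ w ∂L := lintegral_mono_ae hpt
    _ = ∫⁻ w, F₁ w ∂(localGibbsLaw σ (a s) (u₀ s) (θ₀ s) N Φ) := by
        rw [hlaw, lintegral_withDensity_eq_lintegral_mul L hψm hF₁m]
        simp only [Pi.mul_apply]
    _ ≤ ENNReal.ofReal (Real.exp (p * (δ * ((N : ℝ) + 1)))) := hI₁

/-- **S2 with the order after the budget** — the registered family Rényi stub `stub_windowRenyiFamily`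
of line `Sketch` with its two leading binders `∃ p > 1` and `∀ δ > 0` SWAPPED holds unconditionally (and
with `N₀ = 0`): corollary of `windowRenyiFamily_orderAfterBudget`. The registered order of binders (one
`p` for all budgets) is exactly what the line's transfer consumes (`q = p/(p−1)` fixed before `ε → 0`),
so this theorem isolates the dynamical content of S2 / S2'' as the budget-uniformity of the order.
[folklore] -/
theorem stub_windowRenyiFamily_orderAfterBudget :
    ∀ (t₁ : ℝ) (a θ₀ : ℝ → T3 → ℝ) (u₀ : ℝ → T3 → V3),
    Continuous (Function.uncurry a) → Continuous (Function.uncurry θ₀) →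
    Continuous (Function.uncurry u₀) → (∀ s x, 0 < a s x) → (∀ s x, 0 < θ₀ s x) →
    ∀ σ : ℝ, 0 < σ → σ ≤ 1 / 2 →
    ∀ τ : ℝ, 0 < τ → ∀ δ : ℝ, 0 < δ → ∃ p : ℝ, 1 < p ∧
    ∀ Φ : (N : ℕ) →
      HardSphereFlow (Literature.Analysis.FluidPDE.Torus.geometry (Fin 3)) (hsDiameter σ N) (N + 1),
    ∃ N₀ : ℕ, ∀ N : ℕ, N₀ ≤ N → ∀ s ∈ Icc 0 t₁,
    ∀ r ∈ Icc (0 : ℝ) (τ * ((N : ℝ) + 1) ^ (-(1 / 3 : ℝ))),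
      ∫⁻ z, ENNReal.ofReal (canonicalDensity (Literature.Analysis.FluidPDE.Torus.geometry (Fin 3))
            (hsDiameter σ N) (N + 1) (localGibbsProfile (a s) (u₀ s) (θ₀ s)) ((Φ N).flow (-r) z)) ^ p *
          ENNReal.ofReal (canonicalDensity (Literature.Analysis.FluidPDE.Torus.geometry (Fin 3))
            (hsDiameter σ N) (N + 1) (localGibbsProfile (a s) (u₀ s) (θ₀ s)) z) ^ (1 - p)
        ∂(liouville (Literature.Analysis.FluidPDE.Torus.geometry (Fin 3)) (N + 1) (hsDiameter σ N)) ≤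
      ENNReal.ofReal (Real.exp (p * (δ * ((N : ℝ) + 1)))) := by
  intro t₁ a θ₀ u₀ ha hθ hu ha0 hθ0 σ _ hσ2 τ _ δ hδ
  obtain ⟨p, hp1, hp⟩ := windowRenyiFamily_orderAfterBudget t₁ a θ₀ u₀ ha hθ hu ha0 hθ0 σ hσ2 δ hδ
  exact ⟨p, hp1, fun Φ => ⟨0, fun N _ s hs r _ => hp N (Φ N) s hs r⟩⟩

end Summit.AtomisticToContinuum.HydrodynamicLimit.Theorems.KineticCurrentsLDAlongFamiliesSketch

end
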